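import Summits.CriticalPhenomena.SAWScalingLimit.Theorems.SAWDevelopingMapHexTightPinchDefs
import Literature.Probability.RandomPlanarGeometry.CurvePinch
import Mathlib.Analysis.SpecialFunctions.Pow.Real
import HarnessLib

/-!
# Stub `stub_arcTightOfPinch` of the line `reversal-virgin-disc` (crux `HexTight`, stmt-CriticalPhenomena-5423)

Landing target `Summits/CriticalPhenomena/SAWScalingLimit/Theorems/SAWDevelopingMapHexTightArcTightOfPinch.lean`;
objects (`IsHArc`, `arcCurve`, `arcMass`, `travMass`, `Straddles`, `IsVirgin`) from
`SAWDevelopingMapHexTightReversalDefs.lean`, the two named hypotheses `TravLocalization`, `ArcPinchBound`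
from `SAWDevelopingMapHexTightPinchDefs.lean`. WHAT: CHORDAL TRAVERSAL TIGHTNESS FROM THE PINCH BOUND —
traversal localization (`TravLocalization`) and the two-strand pinch power bound (`ArcPinchBound`, exponent
`1 + s > 1`) imply the rate-free chordal tightness `ArcTraversalTight`: at each aspect `A ≥ 4` and
tolerance `η > 0` there is a threshold `k₀` such that, uniformly over virgin configurations at radius
`N ≥ N₀` and doors `w, w'`, the arcs whose polyline traverses `D(z₀; N/A, N/2)` by `k₀` separate segments
carry at most `η` of the arc mass. HOW (plane geometry in the tree + bookkeeping; lattice units,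
`N = 16 M`, `e = π M / k₀`): `k₀` traversals of `D(z₀; N/A, N/2) ⊇ D(z₀; 6M, 8M)` pinch
(`Curve.exists_pinch_of_hasTraversals`) to FOUR traversals of `D(y; 28e, M)` about a point `y` of the
middle circle `|y - z₀| = 7M`, hence (`exists_dist_circleNet_le`, `Curve.HasTraversals.mono`) of
`D(yᵢ; 42e, M - 14e)` about one of the `k₀` net points `yᵢ` of that circle (`arcTight_cover`); so the
traversal mass is at most the sum over `i < k₀` of the net-point traversal masses
(`arcTight_travMass_le_sum`); each of those is at most `θ · arcMass`, `θ = K ((42e+2)/(M+2))^{1+s}`, by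
`TravLocalization` at `(yᵢ, r₁ = M + 2)` fed with `ArcPinchBound` on the sub-configurations
(`arcTight_netPoint`); and `k₀ θ ≤ (K+1) · 200 · (200/k₀)^s ≤ η` once
`k₀ ≥ 2000 + 200 (200 (K+1)/η)^{1/s}` (`arcTight_ratio_le`, `arcTight_const_le`), `N₀ = 16 max(N_a, k₀)`.
-/

noncomputable section

open scoped BigOperators Classical
open Literature.Probability.LatticeModels Literature.Probability.RandomPlanarGeometry
  Literature.Probability.RandomPlanarGeometry.SAW

namespace Summit.CriticalPhenomena.SAWScalingLimit.Theorems.HexTight.Reversal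

/-! ## API inequalities for `arcMass` / `travMass` -/

section API

variable {H : SimpleGraph HexVertex} {Λ : Finset HexVertex} {w w' : Sym2 HexVertex}

/-- Arc mass is nonnegative (a finite sum of nonnegative weights). -/
theorem arcTight_arcMass_nonneg : 0 ≤ arcMass H Λ w w' := by
  unfold arcMass
  refine Finset.sum_nonneg fun γ _ => ?_
  split_ifs
  · exact pow_nonneg hexCriticalFugacity_pos_lt_one.1.le _
  · exact le_rfl

/-- Traversal mass is monotone in the shell: a larger inner radius and a smaller outer radius give a
larger event (`Curve.HasTraversals.mono'`). -/
theorem arcTight_travMass_mono {k : ℕ} {x : ℂ} {r r' R R' : ℝ} (hr : r ≤ r') (hR : R' ≤ R) :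
    travMass H Λ w w' k x r R ≤ travMass H Λ w w' k x r' R' := by
  unfold travMass
  refine Finset.sum_le_sum fun γ _ => ?_
  have hx : 0 ≤ hexCriticalFugacity ^ γ.length := pow_nonneg hexCriticalFugacity_pos_lt_one.1.le _
  by_cases hE : IsHArc H γ ∧ (arcCurve γ).HasTraversals k x r R
  · rw [if_pos hE, if_pos ⟨hE.1, hE.2.mono' hr hR⟩]
  · rw [if_neg hE]
    split_ifs
    · exact hx
    · exact le_rfl

/-- **Union bound over a cover.** If every arc polyline with `k` traversals of `D(z₀; r, R)` has `k'`
traversals of `D(x i; r', R')` for some `i ∈ S`, then the traversal mass of the first event is at most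
the sum over `i ∈ S` of the traversal masses of the second (termwise: a nonnegative weight counted once on
the left is counted at least once on the right). -/
theorem arcTight_travMass_le_sum {k k' : ℕ} {z₀ : ℂ} {r R r' R' : ℝ} {S : Finset ℕ} {x : ℕ → ℂ}
    (hcov : ∀ γ : HexMidEdgeSAW Λ w w', (arcCurve γ).HasTraversals k z₀ r R →
      ∃ i ∈ S, (arcCurve γ).HasTraversals k' (x i) r' R') :
    travMass H Λ w w' k z₀ r R ≤ ∑ i ∈ S, travMass H Λ w w' k' (x i) r' R' := by
  unfold travMass
  rw [Finset.sum_comm]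
  refine Finset.sum_le_sum fun γ _ => ?_
  have hx : 0 ≤ hexCriticalFugacity ^ γ.length := pow_nonneg hexCriticalFugacity_pos_lt_one.1.le _
  have hnn : ∀ i ∈ S, 0 ≤ (if IsHArc H γ ∧ (arcCurve γ).HasTraversals k' (x i) r' R' then
      hexCriticalFugacity ^ γ.length else 0) := fun i _ => by
    split_ifs
    · exact hx
    · exact le_rfl
  by_cases hE : IsHArc H γ ∧ (arcCurve γ).HasTraversals k z₀ r R
  · rw [if_pos hE]
    obtain ⟨i, hi, hi'⟩ := hcov γ hE.2
    calc hexCriticalFugacity ^ γ.length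
        = (if IsHArc H γ ∧ (arcCurve γ).HasTraversals k' (x i) r' R' then
            hexCriticalFugacity ^ γ.length else 0) := by rw [if_pos ⟨hE.1, hi'⟩]
      _ ≤ ∑ j ∈ S, (if IsHArc H γ ∧ (arcCurve γ).HasTraversals k' (x j) r' R' then
            hexCriticalFugacity ^ γ.length else 0) := Finset.single_le_sum hnn hi
  · rw [if_neg hE]
    exact Finset.sum_nonneg hnn

end API

/-! ## Plane geometry: the pinch cover by the net points of the middle circle -/

/-- The net points of the middle circle `|y - z₀| = 7M` are at distance `7M` from `z₀` (`M ≥ 0`). -/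
theorem arcTight_dist_netPoint {z₀ : ℂ} {M : ℝ} (hM : 0 ≤ M) (k₀ i : ℕ) :
    dist (z₀ + ((7 * M : ℝ) : ℂ) *
      Complex.exp (((-Real.pi + 2 * Real.pi * i / k₀ : ℝ) : ℂ) * Complex.I)) z₀ = 7 * M := by
  rw [Complex.dist_eq, add_sub_cancel_left, norm_mul, Complex.norm_real, Real.norm_eq_abs,
    abs_of_nonneg (by positivity), Complex.norm_exp_ofReal_mul_I, mul_one]

/-- **Pinch cover.** `k₀ ≥ 2` separate traversals of `D(z₀; 16M/A, 8M)` (`A ≥ 4`, so the shell contains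
`D(z₀; 6M, 8M)`) force four separate traversals of `D(yᵢ; 42e, M - 14e)`, `e = πM/k₀`, about one of the
`k₀` net points `yᵢ = z₀ + 7M e^{i(-π + 2πi/k₀)}` of the middle circle: pigeonhole on the middle circle
(`Curve.exists_pinch_of_hasTraversals`: four traversals of `D(y; 28e, M)`, `|y - z₀| = 7M`), the net
(`exists_dist_circleNet_le`: `|y - yᵢ| ≤ 14e`) and re-centring (`Curve.HasTraversals.mono`). -/
theorem arcTight_cover {γ : Curve ℂ} {z₀ : ℂ} {M A : ℝ} {k₀ : ℕ} (hM : 0 < M) (hA : 4 ≤ A)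
    (hk : 2 ≤ k₀) (h : γ.HasTraversals k₀ z₀ (16 * M / A) (16 * M / 2)) :
    ∃ i < k₀, γ.HasTraversals 4 (z₀ + ((7 * M : ℝ) : ℂ) *
        Complex.exp (((-Real.pi + 2 * Real.pi * i / k₀ : ℝ) : ℂ) * Complex.I))
      (42 * (Real.pi * M / k₀)) (M - 14 * (Real.pi * M / k₀)) := by
  have hA4 : 16 * M / A ≤ 16 * M / 4 :=
    div_le_div_of_nonneg_left (by positivity) (by norm_num) hA
  have h1 : γ.HasTraversals k₀ z₀ (6 * M) (8 * M) := h.mono' (by linarith) (by linarith)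
  obtain ⟨y, hy, h4⟩ :=
    Curve.exists_pinch_of_hasTraversals (by positivity : (0 : ℝ) ≤ 6 * M) (by linarith) hk h1
  have h7 : (6 * M + 8 * M) / 2 = 7 * M := by ring
  have h8 : (8 * M - 6 * M) / 2 = M := by ring
  rw [h7] at hy h4
  rw [h8] at h4
  have hk1 : 1 ≤ k₀ := le_trans (by norm_num) hk
  obtain ⟨i, hi, hd⟩ := exists_dist_circleNet_le (by positivity : (0 : ℝ) < 7 * M) hy hk1
  refine ⟨i, hi, h4.mono ?_ ?_⟩
  · have : 4 * Real.pi * (7 * M) / k₀ = 28 * (Real.pi * M / k₀) := by ring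
    have : 2 * Real.pi * (7 * M) / k₀ = 14 * (Real.pi * M / k₀) := by ring
    linarith
  · have : 2 * Real.pi * (7 * M) / k₀ = 14 * (Real.pi * M / k₀) := by ring
    linarith

/-! ## One net point: localization + the pinch bound -/

/-- **The charge of one net point.** In a virgin `16M`-disc about `z₀` with doors `{u, c}`, `{u', c'}` on the
rim, for a centre `y` on the middle circle `|y - z₀| = 7M` and `0 ≤ 500 e ≤ M`, `M ≥ 2000`, `M ≥ N_a`:
traversal localization at `(y, r₁ = M + 2)` (the configuration is virgin there, both doors are `≥ 9M` away)
reduces the four-traversal mass of `D(y; 42e, M - 14e)` to the sub-configurations' four-traversal masses of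
`D(y; 42e + 2, M - 14e - 2) ⊆ D(y; 42e + 2, (M+2)/2)`-events, which the pinch bound at radius `M + 2`,
inner radius `42e + 2 ∈ [1, (M+2)/4]`, charges `K ((42e+2)/(M+2))^{1+s}`. -/
theorem arcTight_netPoint (hTL : TravLocalization) {s K Na : ℝ} (hK : 0 ≤ K)
    (hP : ∀ (H : SimpleGraph HexVertex) (Λ : Finset HexVertex) (z₀ : ℂ) (η N : ℝ)
      (w w' : Sym2 HexVertex), Na ≤ N → 1 ≤ η → η ≤ N / 4 →
      IsVirgin H Λ z₀ N → Straddles Λ z₀ N w → Straddles Λ z₀ N w' →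
      travMass H Λ w w' 4 z₀ η (N / 2) ≤ K * (η / N) ^ (1 + s) * arcMass H Λ w w')
    {H : SimpleGraph HexVertex} {Λ : Finset HexVertex} {z₀ y : ℂ} {M e : ℝ}
    {u c u' c' : HexVertex} (hMNa : Na ≤ M) (hM : 2000 ≤ M) (he0 : 0 ≤ e) (he : 500 * e ≤ M)
    (hy : dist y z₀ = 7 * M) (hV : IsVirgin H Λ z₀ (16 * M)) (hu : u ∉ Λ) (hu' : u' ∉ Λ)
    (huc : hexGraph.Adj u c) (huc' : hexGraph.Adj u' c') (huN : 16 * M < dist (hexCenter u) z₀)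
    (huN' : 16 * M < dist (hexCenter u') z₀) :
    travMass H Λ s(u, c) s(u', c') 4 y (42 * e) (M - 14 * e) ≤
      K * ((42 * e + 2) / (M + 2)) ^ (1 + s) * arcMass H Λ s(u, c) s(u', c') := by
  have hθ : 0 ≤ K * ((42 * e + 2) / (M + 2)) ^ (1 + s) :=
    mul_nonneg hK (Real.rpow_nonneg (div_nonneg (by linarith) (by linarith)) _)
  -- both doors are far from `y`
  have hfar : ∀ v : HexVertex, 16 * M < dist (hexCenter v) z₀ → M + 2 < dist (hexCenter v) y := by
    intro v hv
    have := dist_triangle (hexCenter v) y z₀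
    linarith
  -- the configuration is virgin at `(y, M + 2)`
  have hVy : IsVirgin H Λ y (M + 2) := by
    refine ⟨fun v hv => hV.mem v ?_, fun v v' hv hv' hvv' => hV.adj v v' ?_ ?_ hvv'⟩
    · have := dist_triangle (hexCenter v) y z₀
      linarith
    · have := dist_triangle (hexCenter v) y z₀
      linarith
    · have := dist_triangle (hexCenter v') y z₀
      linarith
  refine hTL H Λ y (M + 2) (42 * e) (M - 14 * e) _ 4 u c u' c' (by norm_num) hθ (by linarith)
    (by linarith) (by linarith) hu hu' huc huc' (hfar u huN) (hfar u' huN') hVy ?_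
  intro Λ' m m' _ hV' hm hm'
  calc travMass H Λ' m m' 4 y (42 * e + 2) (M - 14 * e - 2)
      ≤ travMass H Λ' m m' 4 y (42 * e + 2) ((M + 2) / 2) :=
        arcTight_travMass_mono le_rfl (by linarith)
    _ ≤ K * ((42 * e + 2) / (M + 2)) ^ (1 + s) * arcMass H Λ' m m' :=
        hP H Λ' y (42 * e + 2) (M + 2) m m' (by linarith) (by linarith) (by linarith) hV' hm hm'

/-! ## Real arithmetic of the union bound -/

/-- The pinch ratio at a net point is `≤ 200/k₀`: `(42e + 2)/(M + 2) ≤ 200/k₀` for `e k₀ = π M`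
(`π ≤ 4`) and `k₀ ≤ M`. -/
theorem arcTight_ratio_le {e M k : ℝ} (hk : 0 < k) (hkM : k ≤ M)
    (hek : e * k = Real.pi * M) : (42 * e + 2) / (M + 2) ≤ 200 / k := by
  have hM : 0 < M := lt_of_lt_of_le hk hkM
  rw [div_le_div_iff₀ (by linarith) hk]
  have h1 : Real.pi * M ≤ 4 * M := mul_le_mul_of_nonneg_right Real.pi_le_four hM.le
  have h2 : (42 * e + 2) * k = 42 * (e * k) + 2 * k := by ring
  rw [h2, hek]
  linarith

/-- The union bound constant: `k · K t^{1+s} ≤ η` once `0 ≤ t ≤ 200/k ≤ (η / (200 (K+1)))^{1/s}`. -/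
theorem arcTight_const_le {s K η t k : ℝ} (hs : 0 < s) (hK : 0 ≤ K) (hη : 0 < η) (hk : 0 < k)
    (ht0 : 0 ≤ t) (ht : t ≤ 200 / k) (hkt : 200 / k ≤ (η / ((K + 1) * 200)) ^ s⁻¹) :
    k * (K * t ^ (1 + s)) ≤ η := by
  have h200 : 0 < 200 / k := by positivity
  have hq : 0 ≤ η / ((K + 1) * 200) := by positivity
  have h1 : t ^ (1 + s) ≤ (200 / k) ^ (1 + s) := Real.rpow_le_rpow ht0 ht (by linarith)
  have h2 : (200 / k) ^ (1 + s) = 200 / k * (200 / k) ^ s := by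
    rw [Real.rpow_add h200, Real.rpow_one]
  have h3 : (200 / k) ^ s ≤ η / ((K + 1) * 200) := by
    calc (200 / k) ^ s ≤ ((η / ((K + 1) * 200)) ^ s⁻¹) ^ s := Real.rpow_le_rpow h200.le hkt hs.le
      _ = η / ((K + 1) * 200) := Real.rpow_inv_rpow hq hs.ne'
  calc k * (K * t ^ (1 + s)) ≤ k * ((K + 1) * (200 / k) ^ (1 + s)) := by
        refine mul_le_mul_of_nonneg_left ?_ hk.le
        exact mul_le_mul (by linarith) h1 (Real.rpow_nonneg ht0 _) (by linarith)
    _ = (K + 1) * (k * (200 / k)) * (200 / k) ^ s := by rw [h2]; ring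
    _ = (K + 1) * 200 * (200 / k) ^ s := by rw [mul_div_cancel₀ (200 : ℝ) hk.ne']
    _ ≤ (K + 1) * 200 * (η / ((K + 1) * 200)) := by
        exact mul_le_mul_of_nonneg_left h3 (by positivity)
    _ = η := by field_simp

/-! ## The registered stub -/

/-- **stub D — CHORDAL TIGHTNESS FROM THE PINCH BOUND** (`= TravLocalization → ArcPinchBound →
ArcTraversalTight`): pigeonhole on the middle circle + net + union bound + localization. With
`ArcPinchBound`'s `(s, K, N_a)`: `k₀ = ⌈2000 + 200 / t₀⌉₊`, `t₀ = (η/(200 (K+1)))^{1/s}`,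
`N₀ = 16 max(N_a, k₀)`; for `N = 16M ≥ N₀` the `k₀`-traversal mass of `D(z₀; N/A, N/2)` is at most
`Σ_{i<k₀}` (four-traversal mass about the net point `yᵢ`) `≤ k₀ · K ((42e+2)/(M+2))^{1+s} · arcMass ≤
(K+1) 200 (200/k₀)^s · arcMass ≤ η · arcMass`. -/
theorem stub_arcTightOfPinch :
    TravLocalization → ArcPinchBound →
    ∀ A : ℝ, 4 ≤ A → ∀ η : ℝ, 0 < η → ∃ (k₀ : ℕ) (N₀ : ℝ), 0 < N₀ ∧
      ∀ (H : SimpleGraph HexVertex) (Λ : Finset HexVertex) (z₀ : ℂ) (N : ℝ)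
        (w w' : Sym2 HexVertex), N₀ ≤ N →
        IsVirgin H Λ z₀ N → Straddles Λ z₀ N w → Straddles Λ z₀ N w' →
        travMass H Λ w w' k₀ z₀ (N / A) (N / 2) ≤ η * arcMass H Λ w w' := by
  intro hTL hAP A hA η hη
  obtain ⟨s, K, Na, hs, hK, hNa, hP⟩ := hAP
  -- the threshold
  set t₀ : ℝ := (η / ((K + 1) * 200)) ^ s⁻¹ with ht₀_def
  have ht₀ : 0 < t₀ := Real.rpow_pos_of_pos (by positivity) _
  set k₀ : ℕ := ⌈2000 + 200 / t₀⌉₊ with hk₀_def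
  have hk₀ : (2000 : ℝ) + 200 / t₀ ≤ k₀ := Nat.le_ceil _
  have hk2000 : (2000 : ℝ) ≤ k₀ := by linarith [div_nonneg (by norm_num : (0 : ℝ) ≤ 200) ht₀.le]
  have hkpos : (0 : ℝ) < k₀ := by linarith
  have hk2 : 2 ≤ k₀ := by exact_mod_cast (show (2 : ℝ) ≤ k₀ by linarith)
  have hkt : 200 / (k₀ : ℝ) ≤ t₀ := by
    have h : 200 / t₀ ≤ k₀ := by linarith
    rw [div_le_iff₀ ht₀] at h
    rw [div_le_iff₀ hkpos]
    linarith [mul_comm (k₀ : ℝ) t₀]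
  refine ⟨k₀, 16 * max Na k₀, by positivity, ?_⟩
  intro H Λ z₀ N w w' hN hV hw hw'
  obtain ⟨M, rfl⟩ : ∃ M, N = 16 * M := ⟨N / 16, by ring⟩
  have hmax : max Na (k₀ : ℝ) ≤ M := by linarith
  have hMNa : Na ≤ M := le_trans (le_max_left _ _) hmax
  have hkM : (k₀ : ℝ) ≤ M := le_trans (le_max_right _ _) hmax
  have hM : 2000 ≤ M := le_trans hk2000 hkM
  have hM0 : 0 < M := by linarith
  obtain ⟨u, c, rfl, huc, hu, -, -, huN⟩ := hw
  obtain ⟨u', c', rfl, huc', hu', -, -, huN'⟩ := hw'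
  -- the small parameter `e = π M / k₀`
  set e : ℝ := Real.pi * M / k₀ with he_def
  have he0 : 0 ≤ e := by positivity
  have hek : e * k₀ = Real.pi * M := div_mul_cancel₀ _ hkpos.ne'
  have he : 500 * e ≤ M := by
    have h1 : Real.pi * M ≤ 4 * M := mul_le_mul_of_nonneg_right Real.pi_le_four hM0.le
    have h2 : (2000 : ℝ) * M ≤ k₀ * M := mul_le_mul_of_nonneg_right hk2000 hM0.le
    have h3 : 500 * e * k₀ ≤ M * k₀ := by nlinarith
    exact le_of_mul_le_mul_right h3 hkpos
  -- the charge of one net point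
  set θ : ℝ := K * ((42 * e + 2) / (M + 2)) ^ (1 + s) with hθ_def
  have hkθ : (k₀ : ℝ) * θ ≤ η :=
    arcTight_const_le hs hK hη hkpos (div_nonneg (by linarith) (by linarith))
      (arcTight_ratio_le hkpos hkM hek) hkt
  -- the net points
  set y : ℕ → ℂ := fun i => z₀ + ((7 * M : ℝ) : ℂ) *
    Complex.exp (((-Real.pi + 2 * Real.pi * i / k₀ : ℝ) : ℂ) * Complex.I) with hy_def
  have hyd : ∀ i, dist (y i) z₀ = 7 * M := fun i => arcTight_dist_netPoint hM0.le k₀ i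
  calc travMass H Λ s(u, c) s(u', c') k₀ z₀ (16 * M / A) (16 * M / 2)
      ≤ ∑ i ∈ Finset.range k₀, travMass H Λ s(u, c) s(u', c') 4 (y i) (42 * e) (M - 14 * e) := by
        refine arcTight_travMass_le_sum fun γ hγ => ?_
        obtain ⟨i, hi, h⟩ := arcTight_cover hM0 hA hk2 hγ
        exact ⟨i, Finset.mem_range.2 hi, h⟩
    _ ≤ ∑ _i ∈ Finset.range k₀, θ * arcMass H Λ s(u, c) s(u', c') :=
        Finset.sum_le_sum fun i _ =>
          arcTight_netPoint hTL hK hP hMNa hM he0 he (hyd i) hV hu hu' huc huc' huN huN'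
    _ = (k₀ : ℝ) * θ * arcMass H Λ s(u, c) s(u', c') := by
        rw [Finset.sum_const, Finset.card_range, nsmul_eq_mul]
        ring
    _ ≤ η * arcMass H Λ s(u, c) s(u', c') :=
        mul_le_mul_of_nonneg_right hkθ arcTight_arcMass_nonneg

end Summit.CriticalPhenomena.SAWScalingLimit.Theorems.HexTight.Reversal

end
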